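import Summits.MatrixMultiplication.OmegaCensus.SmallFormats.InvertiblePointFrame
import HarnessLib

/-!
# ω-census family (a): NO-GO for 'line-column' footprint shapes at a saturated invertible point of `⟨2,2,n⟩`

Cell `pub-omega` (unit `pub-omega-tensor-g24`), topic `Summits/MatrixMultiplication/OmegaCensus` (sub-folder
`SmallFormats`). Framing (verbatim): lottery ticket; floor = certified bounds/negative ranges. HONEST FRAMING: an
elementary structural lemma over an arbitrary field, continuing `InvertiblePointFrame` (p434823); it deletes one FAMILY
of Kronecker types from the footprint filter of the `𝔽₃` `⟨2,2,6⟩ @ 20` census (tensor gens 23/24, `IP-LAW.md`,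
`TYPE-T-NOGO.md`) — the family `LT1+LT1+J1(a)+J1(b)+J1(c)+J1(d)` behind all 139 orbits the complete DFS left open.
No search, no orbit data; not a rank bound by itself, nothing on `ω`.

**Setting (saturated point moved to `X₀ = 1`).** `β` a bilinear computation of `X ↦ XY` (`X ∈ k^{2×2}`,
`Y ∈ k^{2×n}`), `O` = the terms with `f_i(1) ≠ 0`, `|O| = 2n` (the cap attained), the other terms (`Z`, at most
`2·|J|` of them) vanish at `1`. A set `J` of 'line columns' with nonzero directions `ζ_j ∈ k²` (`j ∈ J`) is a
LINE-COLUMN SHAPE for `β` at `1` if every output `W_t`, `t ∈ Z`, has its `j`-th column on the line `k·ζ_j` for every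
`j ∈ J` (the other columns are free). With `n = 6`, `|J| = 4`, `|Z| = 8` these are exactly the 8-spaces of Kronecker
type `LT1+LT1+J1⁴` of the census (up to the `GL₆` column symmetry), for any eigenvalue pattern.

**Theorem (`not_lineColumnShape_one`).** If `|J| < n` and `|ι| ≤ 2n + 2|J|`, no line-column shape exists.
Proof (all at `X₀ = 1`): (1) by the output footprint (`footprint_w_eq`) the `j`-th column `a` of an off output
`W_s` satisfies `X a − (f_s(X)/f_s(1)) a ∈ k·ζ_j` for all `X`; hence (2) `a ≠ 0 ⇒ a ∉ k·ζ_j` and `f_s` vanishes on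
every `X` with range in `k·ζ_j`; (3) therefore every `W` killed by all `g_t`, `t ∈ Z` (a space `K₀` of dimension
`≥ 2n − |Z| ≥ 2(n − |J|)`) has ALL its line columns zero (Brent at such `X`), i.e. `K₀ ⊆ M₀ :=` matrices supported
on the free columns, `dim M₀ ≤ 2(n−|J|)`, so `K₀ = M₀`; (4) `M₀` is nonzero and stable under `W ↦ XW`, and on `K₀`
Brent plus the frame (`frame_coeff`) give `f_s(1)·g_s(XW) = f_s(X)·g_s(W)`; iterating, some `f_s` (`s ∈ O`) satisfies
`f_s(YX)·f_s(1) = f_s(Y)·f_s(X)` — impossible for a linear functional on `M₂(k)` with `f_s(1) ≠ 0`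
(`E₁₁ = E₁₂E₂₁`, `E₂₂ = E₂₁E₁₂`).
-/

namespace Summit.MatrixMultiplication.OmegaCensus.SmallFormats

open Module Matrix Literature.Computability.AlgebraicComplexity

variable {k : Type*} [Field k] {n : ℕ} {ι : Type*} [Fintype ι] [DecidableEq ι]

/-- `det 1` is a unit (the saturated point after the twist `u ↦ u·X₀ᵀ` is `X₀ = 1`). -/
theorem isUnit_det_one_fin_two : IsUnit (1 : Matrix (Fin 2) (Fin 2) k).det := by
  rw [Matrix.det_one]; exact isUnit_one

/-- No linear functional `h` on `M₂(k)` with `h(1) = c ≠ 0` satisfies `h(AB)·c = h(A)·h(B)` (i.e. `h/c` is never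
multiplicative): `E₁₁ = E₁₂E₂₁` and `E₂₂ = E₂₁E₁₂` force `h(E₁₁) = h(E₂₂) =: a` with `ac = a²` and `2a = c`. -/
theorem not_mul_hom_matrix_two (h : Module.Dual k (Matrix (Fin 2) (Fin 2) k)) {c : k} (hc : c ≠ 0) (h1 : h 1 = c)
    (hm : ∀ A B : Matrix (Fin 2) (Fin 2) k, h (A * B) * c = h A * h B) : False := by
  have e00 : h (single 0 0 1) * c = h (single 0 0 1) * h (single 0 0 1) := by
    have := hm (single 0 0 1) (single 0 0 1); rwa [single_mul_single_same, mul_one] at this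
  have e01 : h (single 0 0 1) * c = h (single 0 1 1) * h (single 1 0 1) := by
    have := hm (single 0 1 1) (single 1 0 1); rwa [single_mul_single_same, mul_one] at this
  have e10 : h (single 1 1 1) * c = h (single 1 0 1) * h (single 0 1 1) := by
    have := hm (single 1 0 1) (single 0 1 1); rwa [single_mul_single_same, mul_one] at this
  have hone : (1 : Matrix (Fin 2) (Fin 2) k) = single 0 0 1 + single 1 1 1 := by
    ext i j; fin_cases i <;> fin_cases j <;> simp
  have hsum : h (single 0 0 1) + h (single 1 1 1) = c := by rw [← map_add, ← hone, h1]
  have hab : h (single 0 0 1) = h (single 1 1 1) := by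
    have : h (single 0 0 1) * c = h (single 1 1 1) * c := by rw [e01, e10, mul_comm]
    exact mul_right_cancel₀ hc this
  set a := h (single 0 0 1) with ha
  rw [← hab] at hsum
  -- `a c = a²`, `2a = c`
  have h2 : a * (c - a) = 0 := by rw [mul_sub, e00]; ring
  rcases mul_eq_zero.mp h2 with h0 | h0
  · apply hc; rw [h0, add_zero] at hsum; exact hsum.symm
  · have hac : a = c := (sub_eq_zero.mp h0).symm
    apply hc
    rw [hac] at hsum
    linear_combination hsum

/-- Left multiplication by the rank-one matrix `z·e_iᵀ` (`X v = v_i·z`) copies row `i`, scaled by `z`: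
`(z e_iᵀ · W)_{r,j} = z_r · W_{i,j}`. -/
theorem vecMulVec_single_mul_apply (z : Fin 2 → k) (i : Fin 2) (W : Matrix (Fin 2) (Fin n) k) (r : Fin 2)
    (j : Fin n) : (vecMulVec z (Pi.single i 1) * W) r j = z r * W i j := by
  simp only [Matrix.mul_apply, vecMulVec_apply, Pi.single_apply, Fin.sum_univ_two]
  fin_cases i <;> simp

section Shape

variable (β : BilinComp (mulBilin k 2 2 n) ι) (O : Finset ι)

/-- **Output footprint at `X₀ = 1`, column form.** If every output `W_t`, `t ∉ O`, has its `j`-th column on the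
line `k·ζ`, then for `s ∈ O` and every `X` the `j`-th column of `X W_s − (f_s(X)/f_s(1)) W_s` lies on that line. -/
theorem footprint_col_one (hO : ∀ i, i ∉ O → β.f i 1 = 0) (hO' : ∀ i ∈ O, β.f i 1 ≠ 0) (hcard : O.card = 2 * n)
    {j : Fin n} {ζ : Fin 2 → k} (hT : ∀ t, t ∉ O → ∃ c : k, ∀ r, β.w t r j = c * ζ r) {s : ι} (hs : s ∈ O)
    (X : Matrix (Fin 2) (Fin 2) k) :
    ∃ d : k, ∀ r, (X * β.w s) r j - β.f s X * (β.f s 1)⁻¹ * β.w s r j = d * ζ r := by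
  classical
  have h := footprint_w_eq β 1 isUnit_det_one_fin_two O hO hO' hcard hs X
  rw [inv_one, Matrix.one_mul] at h
  choose! cf hcf using hT
  refine ⟨∑ t ∈ Finset.univ \ O, β.f t X * β.g t (β.w s) * cf t, fun r => ?_⟩
  have hr := congr_fun (congr_fun h r) j
  rw [Matrix.sub_apply, Matrix.smul_apply, smul_eq_mul] at hr
  rw [hr, Matrix.sum_apply, Finset.sum_mul]
  refine Finset.sum_congr rfl fun t ht => ?_
  rw [Matrix.smul_apply, smul_eq_mul, hcf t (Finset.mem_sdiff.mp ht).2 r]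
  ring

/-- **A line column of an off output is never ON the line** (unless zero): if the `j`-th column of `W_s` (`s ∈ O`)
equals `e·ζ` with `e ≠ 0`, `ζ ≠ 0`, the footprint at `E₁₂` and `E₂₁` forces `ζ = 0`. -/
theorem col_not_on_line (hO : ∀ i, i ∉ O → β.f i 1 = 0) (hO' : ∀ i ∈ O, β.f i 1 ≠ 0) (hcard : O.card = 2 * n)
    {j : Fin n} {ζ : Fin 2 → k} (hζ : ζ ≠ 0) (hT : ∀ t, t ∉ O → ∃ c : k, ∀ r, β.w t r j = c * ζ r) {s : ι}
    (hs : s ∈ O) {e : k} (hcol : ∀ r, β.w s r j = e * ζ r) (he : e ≠ 0) : False := by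
  obtain ⟨d₁, hd₁⟩ := footprint_col_one β O hO hO' hcard hT hs (single 0 1 1)
  obtain ⟨d₂, hd₂⟩ := footprint_col_one β O hO hO' hcard hT hs (single 1 0 1)
  have E1 := hd₁ 0
  have E2 := hd₁ 1
  have E3 := hd₂ 0
  have E4 := hd₂ 1
  rw [single_mul_apply_same, one_mul, hcol 0, hcol 1] at E1
  rw [single_mul_apply_of_ne (h := one_ne_zero), hcol 1] at E2
  rw [single_mul_apply_of_ne (h := zero_ne_one), hcol 0] at E3
  rw [single_mul_apply_same, one_mul, hcol 0, hcol 1] at E4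
  set c₁ := β.f s (single 0 1 1) * (β.f s 1)⁻¹
  set c₂ := β.f s (single 1 0 1) * (β.f s 1)⁻¹
  have hz1 : e * (ζ 1 * ζ 1) = 0 := by linear_combination ζ 1 * E1 - ζ 0 * E2
  have hζ1 : ζ 1 = 0 := by
    rcases mul_eq_zero.mp hz1 with h0 | h0
    · exact absurd h0 he
    · exact mul_self_eq_zero.mp h0
  have hz0 : e * ζ 0 = 0 := by rw [hζ1] at E4; linear_combination E4
  have hζ0 : ζ 0 = 0 := by
    rcases mul_eq_zero.mp hz0 with h0 | h0
    · exact absurd h0 he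
    · exact h0
  apply hζ; funext r; fin_cases r
  · exact hζ0
  · exact hζ1

/-- **Off forms vanish on matrices with range in the line.** If the `j`-th column of `W_s` (`s ∈ O`) is nonzero,
then `f_s(z e_iᵀ) = 0` for `z = ζ_j` and `i = 1, 2` (these `X` map everything into `k·ζ_j`). -/
theorem f_vecMulVec_eq_zero (hO : ∀ i, i ∉ O → β.f i 1 = 0) (hO' : ∀ i ∈ O, β.f i 1 ≠ 0) (hcard : O.card = 2 * n)
    {j : Fin n} {ζ : Fin 2 → k} (hζ : ζ ≠ 0) (hT : ∀ t, t ∉ O → ∃ c : k, ∀ r, β.w t r j = c * ζ r) {s : ι}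
    (hs : s ∈ O) (hne : ∃ r, β.w s r j ≠ 0) (i : Fin 2) : β.f s (vecMulVec ζ (Pi.single i 1)) = 0 := by
  obtain ⟨d, hd⟩ := footprint_col_one β O hO hO' hcard hT hs (vecMulVec ζ (Pi.single i 1))
  simp_rw [vecMulVec_single_mul_apply] at hd
  set c := β.f s (vecMulVec ζ (Pi.single i 1)) * (β.f s 1)⁻¹ with hc
  by_contra hf
  have hcne : c ≠ 0 := mul_ne_zero hf (inv_ne_zero (hO' s hs))
  -- then the column is `((a_i − d)/c)·ζ`: on the line
  have hcol : ∀ r, β.w s r j = (β.w s i j - d) * c⁻¹ * ζ r := fun r => by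
    have := hd r
    field_simp
    linear_combination -this
  by_cases he : (β.w s i j - d) * c⁻¹ = 0
  · obtain ⟨r, hr⟩ := hne
    exact hr (by rw [hcol r, he, zero_mul])
  · exact col_not_on_line β O hO hO' hcard hζ hT hs hcol he

/-- **`K₀ ⊆ M₀`.** A matrix killed by every form `g_t`, `t ∉ O`, has all its line columns ZERO. (Brent at
`X = ζ_j e_iᵀ`: the left side is `ζ_j ⊗ (row i, column j entry)`, the right side vanishes term by term.) -/
theorem lineCol_eq_zero_of_forall_g_eq_zero (hO : ∀ i, i ∉ O → β.f i 1 = 0) (hO' : ∀ i ∈ O, β.f i 1 ≠ 0)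
    (hcard : O.card = 2 * n) {j : Fin n} {ζ : Fin 2 → k} (hζ : ζ ≠ 0)
    (hT : ∀ t, t ∉ O → ∃ c : k, ∀ r, β.w t r j = c * ζ r) {W : Matrix (Fin 2) (Fin n) k}
    (hW : ∀ t, t ∉ O → β.g t W = 0) (i : Fin 2) : W i j = 0 := by
  have hB := β.map_eq_sum (vecMulVec ζ (Pi.single i 1)) W
  rw [mulBilin_apply] at hB
  have hr : ∀ r, ζ r * W i j = 0 := fun r => by
    have h := congr_fun (congr_fun hB r) j
    rw [vecMulVec_single_mul_apply, Matrix.sum_apply] at h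
    rw [h]
    refine Finset.sum_eq_zero fun l _ => ?_
    rw [Matrix.smul_apply, smul_eq_mul]
    by_cases hl : l ∈ O
    · by_cases hcolz : ∃ r', β.w l r' j ≠ 0
      · rw [f_vecMulVec_eq_zero β O hO hO' hcard hζ hT hl hcolz i, zero_mul, zero_mul]
      · push Not at hcolz
        rw [hcolz r, mul_zero]
    · rw [hW l hl, mul_zero, zero_mul]
  obtain ⟨r, hr'⟩ := Function.ne_iff.mp hζ
  rcases mul_eq_zero.mp (hr r) with h0 | h0
  · exact absurd h0 hr'
  · exact h0

/-- **Frame transport on `K₀`.** If `W` is killed by every `g_t`, `t ∉ O`, then for `s ∈ O` and every `X`: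
`f_s(1)·g_s(XW) = f_s(X)·g_s(W)` (Brent without the `Z`-terms, then `frame_coeff`). -/
theorem f_one_mul_g_mul (hO : ∀ i, i ∉ O → β.f i 1 = 0) (hcard : O.card = 2 * n)
    {W : Matrix (Fin 2) (Fin n) k} (hW : ∀ t, t ∉ O → β.g t W = 0) {s : ι} (hs : s ∈ O)
    (X : Matrix (Fin 2) (Fin 2) k) : β.f s 1 * β.g s (X * W) = β.f s X * β.g s W := by
  have hB := β.map_eq_sum X W
  rw [mulBilin_apply] at hB
  have hXW : X * W = ∑ l ∈ O, (β.f l X * β.g l W) • β.w l := by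
    rw [hB, ← Finset.sum_subset (Finset.subset_univ O)]
    intro l _ hl
    rw [hW l hl, mul_zero, zero_smul]
  rw [hXW, map_sum, Finset.mul_sum]
  have hfc : ∀ l ∈ O, β.f s 1 * β.g s ((β.f l X * β.g l W) • β.w l) =
      if s = l then β.f s X * β.g s W else 0 := by
    intro l hl
    have h := frame_coeff β 1 isUnit_det_one_fin_two O hO hcard hs hl
    rw [inv_one, Matrix.one_mul] at h
    rw [map_smul, smul_eq_mul, mul_left_comm, h]
    split_ifs with hsl
    · subst hsl; rw [mul_one]
    · rw [mul_zero]
  rw [Finset.sum_congr rfl hfc, Finset.sum_ite_eq O s, if_pos hs]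

end Shape

/-- **NO-GO for line-column shapes at a saturated point (`X₀ = 1`).** Let `β` compute `X ↦ XY` on `k^{2×2} × k^{2×n}`
with the invertible-point cap attained at `1` (`|O| = 2n`, `O` = the terms not vanishing at `1`). If `J` is a set of
fewer than `n` columns with nonzero directions `ζ_j` and the number of terms is at most `2n + 2|J|`, then it is NOT
the case that every output `W_t` of a term vanishing at `1` has its `j`-th column on the line `k·ζ_j` for all `j ∈ J`.
For `n = 6`, `|ι| = 20`, `|J| = 4` this excludes the Kronecker types `LT1+LT1+J1(a)+J1(b)+J1(c)+J1(d)` (all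
`a,b,c,d ∈ k ∪ {∞}`) as superspaces of `span{W_t : t ∈ Z}` — `TYPE-T-NOGO.md` of tensor g24. -/
theorem not_lineColumnShape_one (β : BilinComp (mulBilin k 2 2 n) ι) (O : Finset ι)
    (hO : ∀ i, i ∉ O → β.f i 1 = 0) (hO' : ∀ i ∈ O, β.f i 1 ≠ 0) (hcard : O.card = 2 * n)
    (J : Finset (Fin n)) (ζ : Fin n → Fin 2 → k) (hζ : ∀ j ∈ J, ζ j ≠ 0) (hJ : J.card < n)
    (hZ : Fintype.card ι ≤ 2 * n + 2 * J.card) :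
    ¬ ∀ t, t ∉ O → ∀ j ∈ J, ∃ c : k, ∀ r, β.w t r j = c * ζ j r := by
  classical
  intro hT
  have hTj : ∀ j ∈ J, ∀ t, t ∉ O → ∃ c : k, ∀ r, β.w t r j = c * ζ j r := fun j hj t ht => hT t ht j hj
  -- `K₀` = common kernel of the `g_t`, `t ∉ O`; `M₀` = span of the unit matrices in the free columns
  set Zs : Finset ι := Finset.univ \ O with hZs
  let φ : Matrix (Fin 2) (Fin n) k →ₗ[k] (Zs → k) := LinearMap.pi fun t => β.g (t : ι)
  set K₀ := LinearMap.ker φ with hK₀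
  have memK₀ : ∀ W, W ∈ K₀ ↔ ∀ t, t ∉ O → β.g t W = 0 := fun W => by
    rw [hK₀, LinearMap.mem_ker]
    constructor
    · intro h t ht
      have := congr_fun h ⟨t, Finset.mem_sdiff.mpr ⟨Finset.mem_univ t, ht⟩⟩
      simpa [φ] using this
    · intro h; funext t; simpa [φ] using h t (Finset.mem_sdiff.mp t.2).2
  set Js : Finset (Fin n) := Finset.univ \ J with hJs
  let b : Fin 2 × Js → Matrix (Fin 2) (Fin n) k := fun p => single p.1 (p.2 : Fin n) (1 : k)
  set M₀ := Submodule.span k (Set.range b) with hM₀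
  -- matrices with zero line columns lie in `M₀`
  have memM₀ : ∀ W : Matrix (Fin 2) (Fin n) k, (∀ j ∈ J, ∀ i, W i j = 0) → W ∈ M₀ := by
    intro W hW
    rw [matrix_eq_sum_single W]
    refine Submodule.sum_mem _ fun i _ => Submodule.sum_mem _ fun j _ => ?_
    by_cases hj : j ∈ J
    · rw [hW j hj i, single_zero]; exact Submodule.zero_mem _
    · have : single i j (W i j) = W i j • b (i, ⟨j, Finset.mem_sdiff.mpr ⟨Finset.mem_univ j, hj⟩⟩) := by
        simp only [b, smul_single, smul_eq_mul, mul_one]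
      rw [this]
      exact Submodule.smul_mem _ _ (Submodule.subset_span ⟨_, rfl⟩)
  -- `K₀ ≤ M₀`
  have hle : K₀ ≤ M₀ := fun W hW =>
    memM₀ W fun j hj i => lineCol_eq_zero_of_forall_g_eq_zero β O hO hO' hcard (hζ j hj) (hTj j hj)
      ((memK₀ W).mp hW) i
  -- dimensions: `dim M₀ ≤ 2(n − |J|) ≤ 2n − |Z| ≤ dim K₀`
  have hdimM : finrank k M₀ ≤ 2 * (n - J.card) := by
    calc finrank k M₀ ≤ Fintype.card (Fin 2 × Js) := finrank_range_le_card b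
      _ = 2 * (n - J.card) := by
          rw [Fintype.card_prod, Fintype.card_fin, Fintype.card_coe, hJs, Finset.card_sdiff,
            Finset.inter_univ, Finset.card_univ, Fintype.card_fin]
  have hdimK : 2 * n ≤ finrank k K₀ + (Fintype.card ι - O.card) := by
    have h1 := LinearMap.finrank_range_add_finrank_ker φ
    rw [finrank_matrix_fin, ← hK₀] at h1
    have h2 : finrank k (LinearMap.range φ) ≤ Fintype.card ι - O.card := by
      calc finrank k (LinearMap.range φ) ≤ finrank k (Zs → k) := Submodule.finrank_le _
        _ = Fintype.card ι - O.card := by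
            rw [finrank_fintype_fun_eq_card, Fintype.card_coe, hZs, Finset.card_sdiff, Finset.inter_univ,
              Finset.card_univ]
    omega
  have hKM : K₀ = M₀ := Submodule.eq_of_le_of_finrank_le hle (by omega)
  -- a nonzero element of `M₀ = K₀` in a free column `j₀ ∉ J`, and its left multiples
  have hJs_ne : Js.Nonempty := by
    rw [← Finset.card_pos, hJs, Finset.card_sdiff, Finset.inter_univ, Finset.card_univ, Fintype.card_fin]; omega
  obtain ⟨j₀, hj₀⟩ := hJs_ne
  have hj₀J : j₀ ∉ J := (Finset.mem_sdiff.mp hj₀).2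
  set W₁ : Matrix (Fin 2) (Fin n) k := single 0 j₀ 1 with hW₁
  have hgK : ∀ W : Matrix (Fin 2) (Fin n) k, (∀ j ∈ J, ∀ i, W i j = 0) → ∀ t, t ∉ O → β.g t W = 0 :=
    fun W hW => (memK₀ W).mp (hKM ▸ memM₀ W hW)
  have hW₁cols : ∀ j ∈ J, ∀ i, W₁ i j = 0 := fun j hj i =>
    single_apply_of_col_ne 0 i (ne_of_mem_of_not_mem hj hj₀J).symm 1
  have hXW₁cols : ∀ X : Matrix (Fin 2) (Fin 2) k, ∀ j ∈ J, ∀ i, (X * W₁) i j = 0 := fun X j hj i =>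
    mul_single_apply_of_ne (c := (1 : k)) 0 j₀ i j (ne_of_mem_of_not_mem hj hj₀J) X
  have hg₁ := hgK W₁ hW₁cols
  -- some `s ∈ O` sees `W₁`
  have hex : ∃ s ∈ O, β.g s W₁ ≠ 0 := by
    by_contra hall
    push Not at hall
    have h := mul_eq_sum_off β 1 O hO W₁
    rw [Matrix.one_mul] at h
    have hzero : W₁ = 0 := by
      rw [h]; exact Finset.sum_eq_zero fun s hs => by rw [hall s hs, mul_zero, zero_smul]
    have : W₁ 0 j₀ = (1 : k) := single_apply_same 0 j₀ 1
    rw [hzero, Matrix.zero_apply] at this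
    exact zero_ne_one this
  obtain ⟨s, hs, hgs⟩ := hex
  -- multiplicativity of `f_s` up to `f_s(1)`
  refine not_mul_hom_matrix_two (β.f s) (hO' s hs) rfl fun A B => ?_
  have h1 := f_one_mul_g_mul β O hO hcard hg₁ hs (A * B)
  have h2 := f_one_mul_g_mul β O hO hcard (hgK (B * W₁) (hXW₁cols B)) hs A
  have h3 := f_one_mul_g_mul β O hO hcard hg₁ hs B
  rw [Matrix.mul_assoc] at h1
  -- `f(1)² g(ABW₁) = f(1) f(AB) g(W₁)` and `= f(A) f(1) g(BW₁) = f(A) f(B) g(W₁)`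
  have key : β.f s (A * B) * β.f s 1 * β.g s W₁ = β.f s A * β.f s B * β.g s W₁ := by
    have e1 : β.f s 1 * (β.f s 1 * β.g s (A * (B * W₁))) = β.f s 1 * (β.f s (A * B) * β.g s W₁) := by rw [h1]
    have e2 : β.f s 1 * (β.f s 1 * β.g s (A * (B * W₁))) = β.f s A * (β.f s 1 * β.g s (B * W₁)) := by
      rw [h2]; ring
    rw [h3] at e2
    linear_combination -e1 + e2
  exact mul_right_cancel₀ hgs key

/-- **The census instance: `⟨2,2,6⟩` with 20 terms, four line columns** (`|Z| = 8 = 2·4`, two free columns).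
At a saturated `X₀ = 1` the outputs of the eight vanishing terms do NOT all have their columns `j ∈ J` (`|J| = 4`)
on prescribed lines `k·ζ_j`: the Kronecker types `LT1+LT1+J1(a)+J1(b)+J1(c)+J1(d)` are excluded as superspaces of
`span{W_t : t ∈ Z}`, over any field and for any eigenvalue pattern. -/
theorem not_lineColumnShape_one_226 {ι : Type*} [Fintype ι] [DecidableEq ι]
    (β : BilinComp (mulBilin k 2 2 6) ι) (hι : Fintype.card ι = 20) (O : Finset ι)
    (hO : ∀ i, i ∉ O → β.f i 1 = 0) (hO' : ∀ i ∈ O, β.f i 1 ≠ 0) (hcard : O.card = 12)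
    (J : Finset (Fin 6)) (hJ : J.card = 4) (ζ : Fin 6 → Fin 2 → k) (hζ : ∀ j ∈ J, ζ j ≠ 0) :
    ¬ ∀ t, t ∉ O → ∀ j ∈ J, ∃ c : k, ∀ r, β.w t r j = c * ζ j r :=
  not_lineColumnShape_one β O hO hO' hcard J ζ hζ (by omega) (by omega)

end Summit.MatrixMultiplication.OmegaCensus.SmallFormats
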